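import Summits.AtomisticToContinuum.HydrodynamicLimit.Theses.JParityClosure
import Summits.AtomisticToContinuum.HydrodynamicLimit.Theorems.InformationPercolationEngineKineticClosureBridge
import Mathlib.MeasureTheory.Constructions.HaarToSphere
import Mathlib.Analysis.SpecialFunctions.Integrability.Basic
import HarnessLib

/-!
# STUB `stub_coarseEntropyIntegrable` of the line `entropy-floor-fixes-energy` (crux `JParityClosure.ParityBandClosure`,
# stmt-AtomisticToContinuum-17608): INTEGRABILITY OF THE COARSE-GRAINED FIELD ENTROPY ON `𝕋³`

WHAT. The registered stub `stub_coarseEntropyIntegrable : CoarseEntropyIntegrable` of the skeleton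
`Cruxes/ParityBandClosure/Lines/entropy_floor_fixes_energy.lean` (v2); the skeleton-local waypoint `CoarseEntropyIntegrable`
is re-declared here VERBATIM (`Lines/` files are never imported) and PROVED: for `0 < σ`, a scale
`0 < r ≤ 1/2`, a band `[0, ηb]` on which `hsExcessFreeEnergy` is continuous, and a configuration `w` of `N + 1`
particles (pairwise distinct velocities) whose `r`-cone-mollified density satisfies `ρ_r(x)σ³ ≤ ηb` everywhere, the
map `x ↦ Hs(ρ_r(x), θ_r(x))` — `Hs`, `ρm`, `mm`, `em`, `θm` those of `EntropyNoDipAt` / `JParityClosure.LocalSecondLaw` —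
is Haar-integrable on `𝕋³`. (Without it the Bochner-integral event of `EntropyNoDipAt` is junk-vacuous.)

PROOF (deterministic real analysis; the distinct-velocity and `r ≤ 1/2` hypotheses are not even used). Write
`bₖ(x) = cone r qₖ x = M tₖ(x)`, `M = 3/(πr³)`, `tₖ = (1 − d(qₖ,x)/r)₊ ∈ [0,1]`, `cᵢⱼ = |vᵢ − vⱼ|²`.
* LAGRANGE IDENTITY (`lagrange_identity`, `theta_eq`): `2(Σbₖ|vₖ|²/2)(Σbₖ) − |Σbₖvₖ|² = ½ΣᵢΣⱼbᵢbⱼcᵢⱼ`, hence on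
  `{ρ_r > 0}` the coarse temperature is `θ_r = ΣᵢΣⱼ bᵢbⱼcᵢⱼ / (6(Σbₖ)²)`.
* LOG SIZE (`abs_log_theta_le`): on `{θ_r > 0}` some term `bᵢbⱼcᵢⱼ` is positive; `θ_r ≤ ΣΣc/6` (each `cᵢⱼ ≤ ΣΣc`) and
  `θ_r ≥ tᵢtⱼcᵢⱼ/(6n²)` (`Σbₖ ≤ nM`), so `|log θ_r(x)| ≤ C(w) + 2Σₖ(−log tₖ(x))`.
* POINTWISE DOMINATION (`abs_entropy_le`, `mul_abs_log_le`): on the good cells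
  `|Hs| ≤ ρ(3/2|log θ| + |log ρ| + |f_ex(ρσ³)|) ≤ A + 3M·Σₖ(−log tₖ(x))`, using `ρ ≤ M`, `ρ|log ρ| ≤ 1 + M²` and
  `|f_ex| ≤ B_f` on the compact band (`IsCompact.exists_bound_of_continuousOn`); off the good cells `Hs = 0`.
* INTEGRABILITY OF `x ↦ −log tₖ(x)` (`integrable_negLog_coneProfile`): translate (`measurePreserving_sub_right`), push
  by the measure-preserving symmetric representative `Torus.measurePreserving_reprSym` to `ℝ³`, where the function is
  radial and supported in the ball of radius `r`; Mathlib's `integrableOn_fun_norm_addHaar` reduces to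
  `∫₀ʳ y²|log(1 − y/r)| dy < ∞` (`intervalIntegral.intervalIntegrable_log'` composed with an affine map).
* MEASURABILITY: `ρ_r, m_r, e_r` are continuous in the centre (`continuous_mollDensity`, `continuous_mollMomentum`,
  `continuous_mollEnergy`), `θ_r` is measurable arithmetic, the good set is measurable, and
  `x ↦ f_ex(ρ_r(x)σ³)` is continuous because the range lies in the band (`ContinuousOn.comp_continuous`) — no
  measurability of `hsExcessFreeEnergy` itself is needed. Conclude with `Integrable.mono'`.

REFERENCES. Elementary; no named fact is invoked — everything is proved from Mathlib and tree lemmas.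
-/

noncomputable section

namespace Summit.AtomisticToContinuum.HydrodynamicLimit.Theorems.ParityBandClosureCoarseEntropy

open scoped BigOperators Topology Classical MeasureTheory ENNReal InnerProductSpace
open Filter Set MeasureTheory
open Literature.MathematicalPhysics.KineticTheory
open Literature.Analysis.FluidPDE
open Summit.AtomisticToContinuum.HydrodynamicLimit.Theses

/-! ## §1 Algebra: the Lagrange identity and the coarse temperature -/

/-- LAGRANGE IDENTITY for weighted velocities: `2·(Σ bᵢ|vᵢ|²/2)·(Σ bⱼ) − |Σ bᵢvᵢ|² = ½ ΣᵢΣⱼ bᵢbⱼ|vᵢ − vⱼ|²`.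
[folklore] -/
theorem lagrange_identity {ι : Type*} [Fintype ι] (b : ι → ℝ) (v : ι → V3) :
    2 * (∑ i, b i * (‖v i‖ ^ 2 / 2)) * (∑ i, b i) - ‖∑ i, b i • v i‖ ^ 2 =
      (1 / 2) * ∑ i, ∑ j, b i * b j * ‖v i - v j‖ ^ 2 := by
  have h1 : ‖∑ i, b i • v i‖ ^ 2 = ∑ i, ∑ j, b i * b j * ⟪v i, v j⟫_ℝ := by
    rw [← real_inner_self_eq_norm_sq, sum_inner]
    refine Finset.sum_congr rfl fun i _ => ?_
    rw [inner_sum]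
    refine Finset.sum_congr rfl fun j _ => ?_
    rw [real_inner_smul_left, real_inner_smul_right]
    ring
  have h5 : 2 * (∑ i, b i * (‖v i‖ ^ 2 / 2)) * (∑ i, b i) = ∑ i, ∑ j, b i * b j * ‖v i‖ ^ 2 := by
    rw [mul_assoc, Finset.sum_mul_sum, Finset.mul_sum]
    refine Finset.sum_congr rfl fun i _ => ?_
    rw [Finset.mul_sum]
    exact Finset.sum_congr rfl fun j _ => by ring
  have h4 : ∑ i, ∑ j, b i * b j * ‖v j‖ ^ 2 = ∑ i, ∑ j, b i * b j * ‖v i‖ ^ 2 := by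
    rw [Finset.sum_comm]
    exact Finset.sum_congr rfl fun i _ => Finset.sum_congr rfl fun j _ => by ring
  have h3 : ∑ i, ∑ j, b i * b j * ‖v i - v j‖ ^ 2 =
      ∑ i, ∑ j, b i * b j * ‖v i‖ ^ 2 + ∑ i, ∑ j, b i * b j * ‖v j‖ ^ 2 -
        2 * ∑ i, ∑ j, b i * b j * ⟪v i, v j⟫_ℝ := by
    rw [Finset.mul_sum, ← Finset.sum_add_distrib, ← Finset.sum_sub_distrib]
    refine Finset.sum_congr rfl fun i _ => ?_
    rw [Finset.mul_sum, ← Finset.sum_add_distrib, ← Finset.sum_sub_distrib]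
    refine Finset.sum_congr rfl fun j _ => ?_
    rw [norm_sub_sq_real]
    ring
  rw [h1, h5, h3, h4]
  ring

/-- The coarse temperature in Lagrange form: with `ρ = n⁻¹Σbᵢ`, `m = n⁻¹Σbᵢvᵢ`, `e = n⁻¹Σbᵢ|vᵢ|²/2` and `Σbᵢ ≠ 0`,
`(2/3)(e/ρ − |m|²/(2ρ²)) = ΣᵢΣⱼ bᵢbⱼ|vᵢ − vⱼ|² / (6(Σbᵢ)²)`. [folklore] -/
theorem theta_eq {ι : Type*} [Fintype ι] (b : ι → ℝ) (v : ι → V3) {n : ℝ} (hn : 0 < n)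
    (hSb : ∑ i, b i ≠ 0) :
    2 / 3 * ((n⁻¹ * ∑ i, b i * (‖v i‖ ^ 2 / 2)) / (n⁻¹ * ∑ i, b i) -
      ‖n⁻¹ • ∑ i, b i • v i‖ ^ 2 / (2 * (n⁻¹ * ∑ i, b i) ^ 2)) =
      (∑ i, ∑ j, b i * b j * ‖v i - v j‖ ^ 2) / (6 * (∑ i, b i) ^ 2) := by
  have key := lagrange_identity b v
  have hSm : ‖∑ i, b i • v i‖ ^ 2 =
      2 * (∑ i, b i * (‖v i‖ ^ 2 / 2)) * (∑ i, b i) - (1 / 2) * ∑ i, ∑ j, b i * b j * ‖v i - v j‖ ^ 2 := by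
    linarith
  rw [norm_smul, Real.norm_eq_abs, abs_inv, abs_of_pos hn, mul_pow, hSm]
  field_simp
  ring

/-! ## §2 Pointwise domination -/

/-- LOG-SIZE OF THE COARSE TEMPERATURE. For weights `bₖ = M tₖ`, `tₖ ∈ [0,1]`, nonnegative pair costs `cᵢⱼ` and
`0 < θ = ΣᵢΣⱼ bᵢbⱼcᵢⱼ / (6(Σbₖ)²)`: `|log θ| ≤ |log(ΣΣc/6)| + ΣᵢΣⱼ|log(cᵢⱼ/(6n²))| + 2Σₖ(−log tₖ)` — above by
`cᵢⱼ ≤ ΣΣc`, below by ONE positive term `bᵢbⱼcᵢⱼ` and `Σbₖ ≤ nM`. [folklore] -/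
theorem abs_log_theta_le {ι : Type*} [Fintype ι] {M : ℝ} (hM : 0 < M) (t : ι → ℝ)
    (ht0 : ∀ k, 0 ≤ t k) (ht1 : ∀ k, t k ≤ 1) (c : ι → ι → ℝ) (hc : ∀ i j, 0 ≤ c i j) {θ : ℝ}
    (hθ : 0 < θ) (hθeq : θ = (∑ i, ∑ j, M * t i * (M * t j) * c i j) / (6 * (∑ i, M * t i) ^ 2)) :
    |Real.log θ| ≤ |Real.log ((∑ i, ∑ j, c i j) / 6)| +
      ∑ i, ∑ j, |Real.log (c i j / (6 * (Fintype.card ι : ℝ) ^ 2))| + 2 * ∑ k, -Real.log (t k) := by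
  set S : ℝ := ∑ i, ∑ j, M * t i * (M * t j) * c i j with hS
  set Sb : ℝ := ∑ i, M * t i with hSb
  set D : ℝ := ∑ i, ∑ j, c i j with hD
  set n : ℝ := (Fintype.card ι : ℝ) with hn
  have hb0 : ∀ k, 0 ≤ M * t k := fun k => mul_nonneg hM.le (ht0 k)
  have hSb0 : 0 ≤ Sb := Finset.sum_nonneg fun k _ => hb0 k
  have hterm0 : ∀ i j, 0 ≤ M * t i * (M * t j) * c i j := fun i j =>
    mul_nonneg (mul_nonneg (hb0 i) (hb0 j)) (hc i j)
  have hrow0 : ∀ i, 0 ≤ ∑ j, M * t i * (M * t j) * c i j := fun i => Finset.sum_nonneg fun j _ => hterm0 i j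
  -- `Σ b > 0` and `S > 0`
  have hSbpos : 0 < Sb := hSb0.lt_of_ne fun h => by rw [hθeq, ← h] at hθ; simp at hθ
  have hSpos : 0 < S := by
    rw [hθeq] at hθ
    exact (div_pos_iff_of_pos_right (by positivity)).1 hθ
  -- one positive term
  obtain ⟨i, -, hi⟩ := (Finset.sum_pos_iff_of_nonneg fun i _ => hrow0 i).1 hSpos
  obtain ⟨j, -, hij⟩ := (Finset.sum_pos_iff_of_nonneg fun j _ => hterm0 i j).1 hi
  have hti : 0 < t i := (ht0 i).lt_of_ne fun h => by rw [← h] at hij; simp at hij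
  have htj : 0 < t j := (ht0 j).lt_of_ne fun h => by rw [← h] at hij; simp at hij
  have hcij : 0 < c i j := (hc i j).lt_of_ne fun h => by rw [← h] at hij; simp at hij
  have hnpos : 0 < n := by
    have : Nonempty ι := ⟨i⟩
    rw [hn]
    exact_mod_cast Fintype.card_pos
  -- upper bound `θ ≤ D / 6`
  have hcD : ∀ i j, c i j ≤ D := fun i j =>
    (Finset.single_le_sum (f := fun j => c i j) (fun j _ => hc i j) (Finset.mem_univ j)).trans
      (Finset.single_le_sum (f := fun i => ∑ j, c i j) (fun i _ => Finset.sum_nonneg fun j _ => hc i j)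
        (Finset.mem_univ i))
  have hSle : S ≤ D * Sb ^ 2 := by
    calc S ≤ ∑ i, ∑ j, M * t i * (M * t j) * D := by
          refine Finset.sum_le_sum fun i _ => Finset.sum_le_sum fun j _ => ?_
          exact mul_le_mul_of_nonneg_left (hcD i j) (mul_nonneg (hb0 i) (hb0 j))
      _ = D * Sb ^ 2 := by
          rw [hSb, sq, Finset.sum_mul_sum, Finset.mul_sum]
          refine Finset.sum_congr rfl fun i _ => ?_
          rw [Finset.mul_sum]
          exact Finset.sum_congr rfl fun j _ => by ring
  have hθle : θ ≤ D / 6 := by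
    rw [hθeq, div_le_div_iff₀ (by positivity) (by norm_num)]
    nlinarith [hSle]
  -- lower bound `t i * t j * (c i j / (6 n²)) ≤ θ`
  have hSbn : Sb ≤ n * M := by
    calc Sb ≤ ∑ _k : ι, M := Finset.sum_le_sum fun k _ => by nlinarith [ht1 k]
      _ = n * M := by rw [Finset.sum_const, Finset.card_univ, nsmul_eq_mul]
  have hone : M * t i * (M * t j) * c i j ≤ S :=
    (Finset.single_le_sum (f := fun j => M * t i * (M * t j) * c i j) (fun j _ => hterm0 i j)
      (Finset.mem_univ j)).trans
      (Finset.single_le_sum (f := fun i => ∑ j, M * t i * (M * t j) * c i j) (fun i _ => hrow0 i)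
        (Finset.mem_univ i))
  have hθge : t i * t j * (c i j / (6 * n ^ 2)) ≤ θ := by
    rw [hθeq]
    calc t i * t j * (c i j / (6 * n ^ 2)) = M * t i * (M * t j) * c i j / (6 * (n * M) ^ 2) := by
          field_simp
      _ ≤ M * t i * (M * t j) * c i j / (6 * Sb ^ 2) := by
          apply div_le_div_of_nonneg_left (hterm0 i j) (by positivity)
          gcongr
      _ ≤ S / (6 * Sb ^ 2) := by
          gcongr
  -- logarithms
  have hlogup : Real.log θ ≤ |Real.log (D / 6)| := (Real.log_le_log hθ hθle).trans (le_abs_self _)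
  have hneg0 : ∀ k, 0 ≤ -Real.log (t k) := fun k => neg_nonneg.2 (Real.log_nonpos (ht0 k) (ht1 k))
  have hPi : -Real.log (t i) ≤ ∑ k, -Real.log (t k) :=
    Finset.single_le_sum (f := fun k => -Real.log (t k)) (fun k _ => hneg0 k) (Finset.mem_univ i)
  have hPj : -Real.log (t j) ≤ ∑ k, -Real.log (t k) :=
    Finset.single_le_sum (f := fun k => -Real.log (t k)) (fun k _ => hneg0 k) (Finset.mem_univ j)
  have hK : |Real.log (c i j / (6 * n ^ 2))| ≤ ∑ i', ∑ j', |Real.log (c i' j' / (6 * n ^ 2))| :=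
    (Finset.single_le_sum (f := fun j' => |Real.log (c i j' / (6 * n ^ 2))|) (fun _ _ => abs_nonneg _)
      (Finset.mem_univ j)).trans
      (Finset.single_le_sum (f := fun i' => ∑ j', |Real.log (c i' j' / (6 * n ^ 2))|)
        (fun _ _ => Finset.sum_nonneg fun _ _ => abs_nonneg _) (Finset.mem_univ i))
  have hloglo : Real.log (t i) + Real.log (t j) + Real.log (c i j / (6 * n ^ 2)) ≤ Real.log θ := by
    rw [← Real.log_mul hti.ne' htj.ne', ← Real.log_mul (by positivity) (by positivity)]
    exact Real.log_le_log (by positivity) hθge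
  have hKabs := neg_abs_le (Real.log (c i j / (6 * n ^ 2)))
  have hDabs := abs_nonneg (Real.log (D / 6))
  have hsum0 : 0 ≤ ∑ k, -Real.log (t k) := Finset.sum_nonneg fun k _ => hneg0 k
  have hKsum0 : 0 ≤ ∑ i', ∑ j', |Real.log (c i' j' / (6 * n ^ 2))| :=
    Finset.sum_nonneg fun _ _ => Finset.sum_nonneg fun _ _ => abs_nonneg _
  rw [abs_le]
  constructor
  · linarith
  · linarith

/-- `ρ|log ρ| ≤ 1 + M²` for `0 < ρ ≤ M`. [folklore] -/
theorem mul_abs_log_le {ρ M : ℝ} (hρ : 0 < ρ) (hρM : ρ ≤ M) : ρ * |Real.log ρ| ≤ 1 + M ^ 2 := by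
  rcases le_or_gt ρ 1 with h | h
  · have h1 := Real.abs_log_mul_self_lt ρ hρ h
    rw [abs_mul, abs_of_pos hρ] at h1
    nlinarith [sq_nonneg M, abs_nonneg (Real.log ρ)]
  · have hl : 0 ≤ Real.log ρ := Real.log_nonneg h.le
    rw [abs_of_nonneg hl]
    have h2 := Real.log_le_sub_one_of_pos hρ
    nlinarith [mul_le_mul_of_nonneg_left h2 hρ.le, mul_self_le_mul_self hρ.le hρM]

/-- Pointwise size of the field entropy on a good cell: `|−ρ(3/2 log θ − log ρ − F)| ≤ A + 3MΦ` once `0 < ρ ≤ M`,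
`|log θ| ≤ C + 2Φ` and `|F| ≤ B_f`. [folklore] -/
theorem abs_entropy_le {ρ θ M F Bf C Φ : ℝ} (hρ : 0 < ρ) (hρM : ρ ≤ M) (hlog : |Real.log θ| ≤ C + 2 * Φ)
    (hF : |F| ≤ Bf) :
    |-(ρ * (3 / 2 * Real.log θ - Real.log ρ - F))| ≤ 3 / 2 * M * C + (1 + M ^ 2) + M * Bf + 3 * M * Φ := by
  rw [abs_neg, abs_mul, abs_of_pos hρ]
  have hM : 0 < M := hρ.trans_le hρM
  have h1 : |3 / 2 * Real.log θ - Real.log ρ - F| ≤ 3 / 2 * |Real.log θ| + |Real.log ρ| + |F| := by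
    calc |3 / 2 * Real.log θ - Real.log ρ - F| ≤ |3 / 2 * Real.log θ - Real.log ρ| + |F| := abs_sub _ _
      _ ≤ |3 / 2 * Real.log θ| + |Real.log ρ| + |F| := by
          gcongr
          exact abs_sub _ _
      _ = 3 / 2 * |Real.log θ| + |Real.log ρ| + |F| := by
          rw [abs_mul, abs_of_pos (by norm_num : (0 : ℝ) < 3 / 2)]
  have h2 : ρ * |Real.log ρ| ≤ 1 + M ^ 2 := mul_abs_log_le hρ hρM
  have h3 : ρ * |Real.log θ| ≤ M * (C + 2 * Φ) := mul_le_mul hρM hlog (abs_nonneg _) hM.le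
  have h4 : ρ * |F| ≤ M * Bf := mul_le_mul hρM hF (abs_nonneg _) hM.le
  calc ρ * |3 / 2 * Real.log θ - Real.log ρ - F| ≤ ρ * (3 / 2 * |Real.log θ| + |Real.log ρ| + |F|) := by
        gcongr
    _ = 3 / 2 * (ρ * |Real.log θ|) + ρ * |Real.log ρ| + ρ * |F| := by ring
    _ ≤ 3 / 2 * (M * (C + 2 * Φ)) + (1 + M ^ 2) + M * Bf := by gcongr
    _ = 3 / 2 * M * C + (1 + M ^ 2) + M * Bf + 3 * M * Φ := by ring

/-! ## §3 The log of the cone profile is integrable on `𝕋³` -/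

/-- INTEGRABILITY OF THE LOG OF THE CONE PROFILE: `x ↦ −log (1 − d(q,x)/r)₊` is Haar-integrable on `𝕋³` (`0 < r`):
translate to `q = 0`, push by the measure-preserving symmetric representative to `ℝ³`, where the function is supported
in the ball of radius `r` and radial, `∫₀ʳ y²|log(1 − y/r)| dy < ∞`. [folklore] -/
theorem integrable_negLog_coneProfile {r : ℝ} (hr : 0 < r) (q : T3) :
    Integrable (fun x : T3 => -Real.log (max (1 - Torus.euclidDist q x / r) 0)) volume := by
  set G : ℝ → ℝ := fun s => -Real.log (max (1 - s / r) 0) with hG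
  -- the radial integral on `(0, r)`
  have h1d : IntegrableOn (fun y : ℝ => y ^ (Module.finrank ℝ V3 - 1) • G y) (Ioo 0 r) volume := by
    rw [finrank_euclideanSpace_fin]
    have hlog : IntervalIntegrable (fun y => Real.log (1 - r⁻¹ * y)) volume 0 r := by
      have h0 := (intervalIntegral.intervalIntegrable_log' (a := 1) (b := 0)).comp_sub_left 1
      have h1 := h0.comp_mul_left (c := r⁻¹)
      simp only [sub_self, sub_zero, div_inv_eq_mul, one_mul, zero_mul] at h1
      exact h1
    have h2 : IntervalIntegrable (fun y => y ^ 2 * Real.log (1 - r⁻¹ * y)) volume 0 r :=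
      hlog.continuousOn_mul (by fun_prop)
    have h3 : IntegrableOn (fun y => y ^ 2 * Real.log (1 - r⁻¹ * y)) (Ioo 0 r) volume :=
      ((intervalIntegrable_iff_integrableOn_Ioc_of_le hr.le).1 h2).mono_set Ioo_subset_Ioc_self
    refine h3.neg.congr_fun (fun y hy => ?_) measurableSet_Ioo
    have hmax : max (1 - y / r) 0 = 1 - r⁻¹ * y := by
      rw [max_eq_left, div_eq_inv_mul]
      rw [sub_nonneg, div_le_one hr]
      exact hy.2.le
    simp only [hG, smul_eq_mul, hmax, Pi.neg_apply]
    norm_num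
  -- on `ℝ³`: radial reduction, support in the ball of radius `r`
  have hball : IntegrableOn (fun v : V3 => G ‖v‖) (Metric.ball 0 r) volume :=
    (integrableOn_fun_norm_addHaar volume).2 h1d
  have hsupp : Function.support (fun v : V3 => G ‖v‖) ⊆ Metric.ball 0 r := by
    intro v hv
    rw [Function.mem_support] at hv
    rw [Metric.mem_ball, dist_zero_right]
    by_contra h
    apply hv
    simp only [hG]
    rw [max_eq_right, Real.log_zero, neg_zero]
    rw [sub_nonpos, le_div_iff₀ hr, one_mul]
    exact not_lt.1 h
  have hE : Integrable (fun v : V3 => G ‖v‖) volume :=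
    (integrableOn_iff_integrable_of_support_subset hsupp).1 hball
  -- on `𝕋³`, centred at `0`: the symmetric representative is measure preserving onto the cube
  have hT : Integrable (fun y : T3 => G ‖Torus.reprSym y‖) volume :=
    (Torus.measurePreserving_reprSym (d := Fin 3)).integrable_comp_of_integrable
      (hE.integrableOn (s := Torus.symCube (Fin 3)))
  -- translate (Haar measure is translation invariant)
  have hfin : Integrable (fun x : T3 => G ‖Torus.reprSym (x - q)‖) volume :=
    (measurePreserving_sub_right volume q).integrable_comp_of_integrable hT
  have heq : (fun x : T3 => -Real.log (max (1 - Torus.euclidDist q x / r) 0)) =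
      fun x => G ‖Torus.reprSym (x - q)‖ := by
    funext x
    simp only [hG]
    rw [Torus.euclidDist_comm, Torus.euclidDist_eq]
  rw [heq]
  exact hfin

/-! ## §4 The stub -/

/-- **The skeleton-local waypoint `CoarseEntropyIntegrable`, VERBATIM** (skeleton v2 of
`Cruxes/ParityBandClosure/Lines/entropy_floor_fixes_energy.lean`). Re-declared here ONLY because `Lines/` files are never
imported, so that the registered stub header `stub_coarseEntropyIntegrable : CoarseEntropyIntegrable` is matched by
name + signature; it is PROVED below (`stub_coarseEntropyIntegrable`), not posited, and is not a literature fact. The two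
`def`s are syntactically identical, hence definitionally equal: the lead closes the skeleton's `sorry` by
`exact ParityBandClosureCoarseEntropy.stub_coarseEntropyIntegrable`. -/
def CoarseEntropyIntegrable : Prop :=
  ∀ (σ r ηb : ℝ), 0 < σ → 0 < r → r ≤ 1 / 2 → ContinuousOn hsExcessFreeEnergy (Set.Icc 0 ηb) →
    ∀ (N : ℕ) (w : Config (N + 1) (Fin 3) T3), (∀ i j : Fin (N + 1), i ≠ j → (w i).2 ≠ (w j).2) →
    let bx : T3 → T3 → ℝ := fun x y => 3 / (Real.pi * r ^ 3) * max (1 - Torus.euclidDist x y / r) 0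
    let ρm : Config (N + 1) (Fin 3) T3 → T3 → ℝ := fun w x₀ => ∫ q, bx q.1 x₀ ∂(empiricalMeasure w)
    let mm : Config (N + 1) (Fin 3) T3 → T3 → V3 := fun w x₀ => ∫ q, bx q.1 x₀ • q.2 ∂(empiricalMeasure w)
    let em : Config (N + 1) (Fin 3) T3 → T3 → ℝ := fun w x₀ =>
      ∫ q, bx q.1 x₀ * (‖q.2‖ ^ 2 / 2) ∂(empiricalMeasure w)
    let θm : Config (N + 1) (Fin 3) T3 → T3 → ℝ := fun w x₀ =>
      2 / 3 * (em w x₀ / ρm w x₀ - ‖mm w x₀‖ ^ 2 / (2 * ρm w x₀ ^ 2))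
    let Hs : ℝ → ℝ → ℝ := fun a b =>
      if 0 < a ∧ 0 < b then -(a * (3 / 2 * Real.log b - Real.log a - hsExcessFreeEnergy (a * σ ^ 3))) else 0
    (∀ x, ρm w x * σ ^ 3 ≤ ηb) →
    Integrable (fun x : T3 => Hs (ρm w x) (θm w x))

/-- **STUB `stub_coarseEntropyIntegrable` (skeleton v2 of the line `entropy-floor-fixes-energy`, crux
`JParityClosure.ParityBandClosure`): integrability on `𝕋³` of the coarse-grained hard-sphere field entropy
`x ↦ Hs(ρ_r(x), θ_r(x))` of a configuration with capped `r`-mollified density**, body VERBATIM the skeleton's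
`CoarseEntropyIntegrable`. Off `{ρ_r > 0, θ_r > 0}` the integrand vanishes; on it, by the Lagrange identity
(`theta_eq`) and `abs_log_theta_le`, `|Hs| ≤ A + 3M Σₖ(−log(1 − d(qₖ,x)/r)₊)` (`abs_entropy_le`), and each
`x ↦ −log(1 − d(qₖ,x)/r)₊` is Haar-integrable (`integrable_negLog_coneProfile`); measurability from the continuity
of the mollified fields and of `f_ex` on the band. The distinct-velocity hypothesis is not needed. [folklore] -/
theorem stub_coarseEntropyIntegrable : CoarseEntropyIntegrable := by
  intro σ r ηb hσ hr _hr2 hf N w _hw bx ρm mm em θm Hs hcap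
  -- vocabulary (definitional): `bx = cone r`, `ρm w = mollDensity r w`, `mm w x` / `em w x` are the empirical
  -- momentum / energy fields tested against `cone r · x`; as finite sums:
  have hρeq : ∀ x, ρm w x = ((N + 1 : ℕ) : ℝ)⁻¹ * ∑ k, DensityCapNegative.cone r (w k).1 x :=
    fun x => DensityCapNegative.mollDensity_eq r w x
  have hmeq : ∀ x, mm w x = ((N + 1 : ℕ) : ℝ)⁻¹ • ∑ k, DensityCapNegative.cone r (w k).1 x • (w k).2 :=
    fun x => empiricalMomentumField_eq_sum w (fun y => DensityCapNegative.cone r y x)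
  have heeq : ∀ x, em w x =
      ((N + 1 : ℕ) : ℝ)⁻¹ * ∑ k, DensityCapNegative.cone r (w k).1 x * (‖(w k).2‖ ^ 2 / 2) :=
    fun x => empiricalEnergyField_eq_sum w (fun y => DensityCapNegative.cone r y x)
  have hnpos : (0 : ℝ) < ((N + 1 : ℕ) : ℝ) := by positivity
  have hMpos : (0 : ℝ) < 3 / (Real.pi * r ^ 3) := by positivity
  have ht1 : ∀ (k : Fin (N + 1)) (x : T3), max (1 - Torus.euclidDist (w k).1 x / r) 0 ≤ 1 := fun k x =>
    max_le (by linarith [div_nonneg (show (0 : ℝ) ≤ Torus.euclidDist (w k).1 x from norm_nonneg _) hr.le])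
      zero_le_one
  -- regularity of the coarse fields
  have hρcont : Continuous fun x => ρm w x := KineticClosureDensity.continuous_mollDensity r w
  have hmcont : Continuous fun x => mm w x := KineticClosureBridge.continuous_mollMomentum r w
  have hecont : Continuous fun x => em w x := KineticClosureBridge.continuous_mollEnergy r w
  have hρnn : ∀ x, 0 ≤ ρm w x := fun x => DensityCapNegative.mollDensity_nonneg hr w x
  have hρle : ∀ x, ρm w x ≤ 3 / (Real.pi * r ^ 3) := fun x => DensityCapNegative.mollDensity_le hr w x
  have hθmeas : Measurable fun x => θm w x := by
    show Measurable fun x => 2 / 3 * (em w x / ρm w x - ‖mm w x‖ ^ 2 / (2 * ρm w x ^ 2))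
    exact measurable_const.mul ((hecont.measurable.div hρcont.measurable).sub
      ((hmcont.measurable.norm.pow_const 2).div (measurable_const.mul (hρcont.measurable.pow_const 2))))
  have hband : ∀ x, ρm w x * σ ^ 3 ∈ Set.Icc 0 ηb := fun x => ⟨mul_nonneg (hρnn x) (by positivity), hcap x⟩
  have hFcont : Continuous fun x => hsExcessFreeEnergy (ρm w x * σ ^ 3) :=
    hf.comp_continuous (hρcont.mul continuous_const) hband
  obtain ⟨Bf, hBf⟩ := isCompact_Icc.exists_bound_of_continuousOn hf
  -- measurability of the integrand (no measurability of `hsExcessFreeEnergy` off the band is needed)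
  have hmeas : Measurable fun x => Hs (ρm w x) (θm w x) := by
    show Measurable fun x => if 0 < ρm w x ∧ 0 < θm w x then
      -(ρm w x * (3 / 2 * Real.log (θm w x) - Real.log (ρm w x) - hsExcessFreeEnergy (ρm w x * σ ^ 3))) else 0
    refine Measurable.ite ?_ ?_ measurable_const
    · exact (measurableSet_lt measurable_const hρcont.measurable).inter
        (measurableSet_lt measurable_const hθmeas)
    · exact (hρcont.measurable.mul (((measurable_const.mul hθmeas.log).sub hρcont.measurable.log).sub
        hFcont.measurable)).neg
  -- the dominating function `A + 3M Σₖ (−log tₖ)`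
  have hΦint : Integrable (fun x : T3 =>
      ∑ k : Fin (N + 1), -Real.log (max (1 - Torus.euclidDist (w k).1 x / r) 0)) volume :=
    integrable_finsetSum _ fun k _ => integrable_negLog_coneProfile hr (w k).1
  have hC0 : 0 ≤ |Real.log ((∑ i : Fin (N + 1), ∑ j : Fin (N + 1), ‖(w i).2 - (w j).2‖ ^ 2) / 6)| +
      ∑ i : Fin (N + 1), ∑ j : Fin (N + 1),
        |Real.log (‖(w i).2 - (w j).2‖ ^ 2 / (6 * (Fintype.card (Fin (N + 1)) : ℝ) ^ 2))| := by
    positivity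
  set C : ℝ := |Real.log ((∑ i : Fin (N + 1), ∑ j : Fin (N + 1), ‖(w i).2 - (w j).2‖ ^ 2) / 6)| +
      ∑ i : Fin (N + 1), ∑ j : Fin (N + 1),
        |Real.log (‖(w i).2 - (w j).2‖ ^ 2 / (6 * (Fintype.card (Fin (N + 1)) : ℝ) ^ 2))| with hC
  have hA0 : 0 ≤ 3 / 2 * (3 / (Real.pi * r ^ 3)) * C + (1 + (3 / (Real.pi * r ^ 3)) ^ 2) +
      3 / (Real.pi * r ^ 3) * |Bf| := by positivity
  set A : ℝ := 3 / 2 * (3 / (Real.pi * r ^ 3)) * C + (1 + (3 / (Real.pi * r ^ 3)) ^ 2) +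
      3 / (Real.pi * r ^ 3) * |Bf| with hA
  refine Integrable.mono' ((integrable_const A).add (hΦint.const_mul (3 * (3 / (Real.pi * r ^ 3)))))
    hmeas.aestronglyMeasurable (ae_of_all _ fun x => ?_)
  show |(if 0 < ρm w x ∧ 0 < θm w x then
      -(ρm w x * (3 / 2 * Real.log (θm w x) - Real.log (ρm w x) - hsExcessFreeEnergy (ρm w x * σ ^ 3))) else 0)| ≤
    A + 3 * (3 / (Real.pi * r ^ 3)) * ∑ k : Fin (N + 1), -Real.log (max (1 - Torus.euclidDist (w k).1 x / r) 0)
  have hΦ0 : 0 ≤ ∑ k : Fin (N + 1), -Real.log (max (1 - Torus.euclidDist (w k).1 x / r) 0) :=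
    Finset.sum_nonneg fun k _ => neg_nonneg.2 (Real.log_nonpos (le_max_right _ _) (ht1 k x))
  split_ifs with hx
  · obtain ⟨hρx, hθx⟩ := hx
    have hSb : ∑ k, DensityCapNegative.cone r (w k).1 x ≠ 0 := by
      intro h0
      rw [hρeq x, h0, mul_zero] at hρx
      exact lt_irrefl _ hρx
    -- Lagrange form of the coarse temperature
    have hθeq : θm w x = (∑ i, ∑ j, DensityCapNegative.cone r (w i).1 x * DensityCapNegative.cone r (w j).1 x *
        ‖(w i).2 - (w j).2‖ ^ 2) / (6 * (∑ k, DensityCapNegative.cone r (w k).1 x) ^ 2) := by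
      show 2 / 3 * (em w x / ρm w x - ‖mm w x‖ ^ 2 / (2 * ρm w x ^ 2)) = _
      rw [hρeq x, hmeq x, heeq x]
      exact theta_eq (fun k => DensityCapNegative.cone r (w k).1 x) (fun k => (w k).2) hnpos hSb
    have hlog : |Real.log (θm w x)| ≤
        C + 2 * ∑ k : Fin (N + 1), -Real.log (max (1 - Torus.euclidDist (w k).1 x / r) 0) :=
      abs_log_theta_le hMpos (fun k => max (1 - Torus.euclidDist (w k).1 x / r) 0) (fun k => le_max_right _ _)
        (fun k => ht1 k x) (fun i j => ‖(w i).2 - (w j).2‖ ^ 2) (fun i j => sq_nonneg _) hθx hθeq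
    have hfb : |hsExcessFreeEnergy (ρm w x * σ ^ 3)| ≤ |Bf| := (hBf _ (hband x)).trans (le_abs_self Bf)
    exact abs_entropy_le hρx (hρle x) hlog hfb
  · rw [abs_zero]
    exact add_nonneg hA0 (mul_nonneg (by positivity) hΦ0)

end Summit.AtomisticToContinuum.HydrodynamicLimit.Theorems.ParityBandClosureCoarseEntropy

end
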